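import Summits.ResolutionOfSingularities.ResolutionOfSingularities.Theorems.FrobeniusClosingPatchingRelPerfectDepthMultiHostCylSnc
import Literature.AlgebraicGeometry.Resolution.NormalCrossingsLocal
import Literature.AlgebraicGeometry.Resolution.IdealSheafDescent
import Literature.AlgebraicGeometry.Resolution.BoundaryEquivalence
import HarnessLib

/-!
# Crux `PatchingRelPerfect` (stmt-ResolutionOfSingularities-16161), chain W5.2 — F7(β) d = 2 (β-AX), X2a module 2 (M2a), part 2:
# the pushed centre `j V(C)` and T2a (a) `CylState.hasSNCWith_centre`

[OURS · L1 W5.2 · F7(β) (β-AX) X-side · res-D-pv-034 AS res-L1-s36-pv-3 per res-L1-w52-plan-1 RULING G11-21 (2026-08-27T16:43:39Z)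
and NOTE G11-22; signature of record for `CylState.hasSNCWith_centre` = res-D-pv-016's X2a scratch 3903f92e4eb0069b (RULING G11-9
(1)) = the first existential of the `hlift` hypothesis of res-D-pv-054's T2b-X `…DepthMultiHostCJSTransportStep` (p548298).]
Replaces the role of NO printed item; NOT a statement of the manuscript under review; fact-free, def-free.  AI-written; AI review is
weaker than expert review.  Part 1 (`…CylSnc`): CYL-SNC and the point engine `CylState.exists_isRsopPart_labels_cylinder`.

## Contents
* §3 the pushed centre `W = j V(C)` (`CylState.centre C`) of a REDUCED E-side centre `C = 𝓘(Supp C)`: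
  **`CylState.vanishingIdeal_centre`** (`𝓘(W) = C.map j`, Mathlib's `map_vanishingIdeal`),
  **`CylState.comap_j_vanishingIdeal_centre`** (`𝓘(W)|_Z = C`), `CylState.support_carrier_sup_cylinder`,
  **`CylState.comap_V_ι_vanishingIdeal_centre`** (`𝓘(W)|_V = 𝓘_Z|_V ⊔ q^* C` whenever `C` has snc with some family: both sides
  are radical with support `V ∩ W`) — the identifications res-D-pv-054 asked for (M2b over `RetractionBlowupTransform`,
  `k := jV`, `r := q`, `C_V := 𝓘(W)|_V ⊇ ker k`).
* §4 **`CylState.hasSNCWith_centre`** = T2a (a), VERBATIM 3903f92e4eb0069b (the reducedness binder is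
  part of the signature of record and unused by (a)): `HasSNCWith S.𝓔 𝓘(j V(C))` from `HasSNCWith 𝓑 C` with `𝓑 ∋ bd T` for all
  members `T ≠` carrier — CYL-SNC (part 1) read through the cylinder identities `T|_V = q^*(bd T)` and §3, transported along
  the stalk isomorphisms of `V ↪ X` (`HasSNCWith.injOn_stalkIdeal` keeps the labelling injective); off `V` the centre is absent.

## References
* J. Kollár, *Lectures on Resolution of Singularities* (2007), (3.111) Step 1. [Kollar2007]
* E. Bierstone, D. Grigoriev, P. Milman, J. Włodarczyk, *Effective Hironaka resolution and its complexity*, Asian J. Math. 15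
  (2011), Def. 3.1.1, Def. 3.1.3 (2). [BierstoneGrigorievMilmanWlodarczyk2011]
* H. Matsumura, *Commutative Ring Theory* (1986), Thm. 14.3. [Matsumura1987]
-/

-- `Summit.<Summit>.<Sub>.Theorems` with `Sub = Summit` (single-conjunct summit, D-0017)
set_option linter.dupNamespace false

noncomputable section

open CategoryTheory AlgebraicGeometry TopologicalSpace IsLocalRing
open Literature.AlgebraicGeometry.Resolution
open Scheme.IdealSheafData

namespace Summit.ResolutionOfSingularities.ResolutionOfSingularities.Theorems.DepthMultiHost

universe u

namespace CylState

variable {X : Scheme.{u}} {S : MultiHostState X} (cyl : CylState S)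

/-! ## §3 The pushed centre: `𝓘(j V(C)) = C.map j`, `𝓘(j V(C))|_Z = C`, `𝓘(j V(C))|_V = 𝓘_Z|_V ⊔ q^* C` -/

/-- [OURS · L1 W5.2] **The ideal of the pushed centre** of a REDUCED E-side centre is the pushed ideal: `𝓘(j V(C)) = C.map j`
(Mathlib's `map_vanishingIdeal`; `j V(C)` is closed). [folklore] -/
theorem vanishingIdeal_centre (C : cyl.Z.IdealSheafData) (hC : C = vanishingIdeal C.support) :
    vanishingIdeal (cyl.centre C) = C.map cyl.j := by
  conv_rhs => rw [hC]
  rw [Scheme.IdealSheafData.map_vanishingIdeal]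
  congr 1
  apply Closeds.ext
  rw [Closeds.coe_closure, coe_centre]
  exact (cyl.centre C).isClosed.closure_eq.symm

/-- [OURS · L1 W5.2] **`𝓘(j V(C))|_Z = C`** for a reduced E-side centre. [folklore] -/
theorem comap_j_vanishingIdeal_centre (C : cyl.Z.IdealSheafData) (hC : C = vanishingIdeal C.support) :
    (vanishingIdeal (cyl.centre C)).comap cyl.j = C := by
  haveI := cyl.closedImmersion
  rw [cyl.vanishingIdeal_centre C hC]
  exact comap_map_of_isClosedImmersion cyl.j C

/-- The support of the pushed centre read on `V` is that of `𝓘_Z|_V ⊔ q^* C`. [folklore] -/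
theorem support_carrier_sup_cylinder (C : cyl.Z.IdealSheafData) :
    ((cyl.j.ker.comap cyl.V.ι ⊔ C.comap cyl.q).support : Set (cyl.V : Scheme.{u})) = cyl.V.ι ⁻¹' (cyl.centre C : Set X) := by
  haveI := cyl.closedImmersion
  ext y
  rw [Scheme.IdealSheafData.support_sup, Closeds.coe_inf, Set.mem_inter_iff, SetLike.mem_coe, cyl.mem_support_carrier_iff,
    Set.mem_preimage, cyl.mem_centre_iff, SetLike.mem_coe, support_comap]
  constructor
  · rintro ⟨⟨z, rfl⟩, hC⟩
    refine ⟨z, ?_, (cyl.V_ι_jV z).symm⟩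
    have : cyl.q (cyl.jV z) ∈ C.support := hC
    rwa [cyl.q_jV] at this
  · rintro ⟨z, hz, hjz⟩
    have hy : cyl.jV z = y := cyl.V.ι.isOpenEmbedding.injective (by rw [cyl.V_ι_jV, hjz])
    subst hy
    refine ⟨⟨z, rfl⟩, ?_⟩
    show cyl.q (cyl.jV z) ∈ C.support
    rwa [cyl.q_jV]

/-- [OURS · L1 W5.2] **The pushed centre read on the cylinder region**: `𝓘(j V(C))|_V = 𝓘_Z|_V ⊔ q^* C` for a reduced E-side centre
`C` having simple normal crossings with some family (both sides are radical with support `V ∩ j V(C)`). [folklore] -/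
theorem comap_V_ι_vanishingIdeal_centre (C : cyl.Z.IdealSheafData) (𝓕 : List cyl.Z.IdealSheafData) (h : HasSNCWith 𝓕 C) :
    (vanishingIdeal (cyl.centre C)).comap cyl.V.ι = cyl.j.ker.comap cyl.V.ι ⊔ C.comap cyl.q := by
  rw [comap_vanishingIdeal_of_isOpenImmersion]
  symm
  apply eq_vanishingIdeal_of_radical
  · -- radical: the stalks are prime or the unit ideal
    refine le_antisymm (le_of_forall_stalkIdeal_le fun y => ?_) (Scheme.IdealSheafData.le_radical _)
    rw [stalkIdeal_radical]
    by_cases hy : y ∈ (cyl.j.ker.comap cyl.V.ι ⊔ C.comap cyl.q).support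
    · obtain ⟨m, z, hz, -, -, hW⟩ := cyl.exists_isRsopPart_labels_cylinder 𝓕 C h y
      obtain ⟨T, hT⟩ := hW hy
      rw [hT]
      exact (hz.isPrime_span_image T).isRadical.radical_le_iff.mpr le_rfl
    · rw [stalkIdeal_eq_top_of_not_mem_support hy]
      exact le_top
  · apply Closeds.ext
    rw [cyl.support_carrier_sup_cylinder C, Closeds.coe_preimage]

/-! ## §4 T2a (a): the pushed centre has simple normal crossings with the member family -/

/-- [OURS · L1 W5.2 · F7(β) (β-AX) T2a (a)] **snc transfer to the pushed centre** (`CylState.hasSNCWith_centre`, X2a module 2,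
signature of record 3903f92e4eb0069b): a REDUCED centre `C` on the carrier having simple normal crossings with a family `𝓑`
containing the traces `bd T` of all members `T ≠` carrier has, pushed into `X` as `j V(C)`, simple normal crossings with the member
family `S.𝓔`.  Off the cylinder region the centre is absent; on it, CYL-SNC for `𝓑` read through the cylinder identities
`T|_V = q^*(bd T)` and `𝓘(j V(C))|_V = 𝓘_Z|_V ⊔ q^* C`, transported along the stalk isomorphisms of the open immersion `V ↪ X`.
[cite: Kollar2007, (3.111) Step 1] [cite: BierstoneGrigorievMilmanWlodarczyk2011, Def. 3.1.3 (2)] -/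
theorem hasSNCWith_centre [IsLocallyNoetherian X] (C : cyl.Z.IdealSheafData) (_hC : C = vanishingIdeal C.support)
    (𝓑 : List cyl.Z.IdealSheafData) (h𝓑 : ∀ T ∈ S.𝓔, T ≠ cyl.j.ker → cyl.bd T ∈ 𝓑) (hsnc : HasSNCWith 𝓑 C) :
    HasSNCWith S.𝓔 (vanishingIdeal (cyl.centre C)) := by
  classical
  -- reducedness of `C` (`_hC`) is not needed for (a); the binder is part of the signature of record
  have hW : (vanishingIdeal (cyl.centre C)).comap cyl.V.ι = cyl.j.ker.comap cyl.V.ι ⊔ C.comap cyl.q :=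
    cyl.comap_V_ι_vanishingIdeal_centre C 𝓑 hsnc
  refine hasSNCWith_of_isRsopPart_labels _ _ fun x => ?_
  by_cases hxV : x ∈ (cyl.V : Set X)
  · -- a point of the cylinder region: transport CYL-SNC along `𝒪_{X,x} ≅ 𝒪_{V,y}`
    obtain ⟨y, rfl⟩ : ∃ y : (cyl.V : Scheme.{u}), cyl.V.ι y = x := by
      rw [← Scheme.Opens.range_ι] at hxV; exact hxV
    obtain ⟨m, z, hz, ⟨lab, hlab, hlabD⟩, -, hWy⟩ := cyl.exists_isRsopPart_labels_cylinder 𝓑 C hsnc y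
    let e : X.presheaf.stalk (cyl.V.ι y) ≃+* (cyl.V : Scheme.{u}).presheaf.stalk y :=
      (asIso (cyl.V.ι.stalkMap y)).commRingCatIsoToRingEquiv
    have he : ∀ K : X.IdealSheafData, stalkIdeal (K.comap cyl.V.ι) y = (stalkIdeal K (cyl.V.ι y)).map e := fun K =>
      stalkIdeal_comap_eq_map_stalkMap cyl.V.ι K y
    have he' : ∀ K : X.IdealSheafData, stalkIdeal K (cyl.V.ι y) = (stalkIdeal (K.comap cyl.V.ι) y).map e.symm := fun K => by
      rw [he, Ideal.map_symm, Ideal.comap_map_of_bijective _ e.bijective]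
    -- every member through `x` restricts to a member of the cylinder family through `y`
    have hmem : ∀ D : {D : X.IdealSheafData // D ∈ S.𝓔 ∧ cyl.V.ι y ∈ D.support},
        D.1.comap cyl.V.ι ∈ (cyl.j.ker.comap cyl.V.ι :: 𝓑.map fun F => F.comap cyl.q) ∧
          y ∈ (D.1.comap cyl.V.ι).support := by
      rintro ⟨D, hD, hxD⟩
      refine ⟨?_, by rw [support_comap]; exact hxD⟩
      by_cases hDc : D = cyl.j.ker
      · subst hDc; exact List.mem_cons_self
      · rw [cyl.member_eq D hD hDc]
        exact List.mem_cons_of_mem _ (List.mem_map.mpr ⟨cyl.bd D, h𝓑 D hD hDc, rfl⟩)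
    refine ⟨m, e.symm ∘ z, isRsopPart_comp_ringEquiv e.symm hz, ⟨fun D => lab ⟨D.1.comap cyl.V.ι, hmem D⟩, ?_, ?_⟩, ?_⟩
    · -- injective: distinct members through `x` have distinct stalks at `x`
      intro D₁ D₂ h12
      have h12' : lab ⟨_, hmem D₁⟩ = lab ⟨_, hmem D₂⟩ := h12
      refine Subtype.ext (S.snc.injOn_stalkIdeal (cyl.V.ι y) D₁.1 D₁.2.1 D₂.1 D₂.2.1 D₁.2.2 D₂.2.2 ?_)
      rw [he', he', hlabD ⟨_, hmem D₁⟩, hlabD ⟨_, hmem D₂⟩, h12']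
    · intro D
      rw [he', hlabD ⟨_, hmem D⟩, Ideal.map_span, Set.image_singleton]
      rfl
    · intro hx
      have hy : y ∈ ((vanishingIdeal (cyl.centre C)).comap cyl.V.ι).support := by
        rw [support_comap]; exact hx
      rw [hW] at hy
      obtain ⟨T, hT⟩ := hWy hy
      refine ⟨T, ?_⟩
      rw [he', hW, hT, Ideal.map_span, Set.image_image]
      rfl
  · -- off the cylinder region the centre is absent
    obtain ⟨m, z, hz, hlab, -⟩ := S.snc.exists_isRsopPart_labels x
    refine ⟨m, z, hz, hlab, fun hx => absurd (cyl.centre_subset_V C ?_) hxV⟩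
    have hx' : x ∈ ((vanishingIdeal (cyl.centre C)).support : Set X) := hx
    rwa [Scheme.IdealSheafData.coe_support_vanishingIdeal] at hx'


end CylState

end Summit.ResolutionOfSingularities.ResolutionOfSingularities.Theorems.DepthMultiHost

end
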